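import Mathlib
import HarnessLib
import HarnessLib.Audit
import Summits.Parity.Statement

/-!
Route: EntropyRate

DORMANT since 2026-09-04T02:20:14Z (reconciler: no traction for 5 d (last activity statement-attached at 2026-08-30T01:27:31Z); parked, not closed — `ledger route dormant route-Parity-EntropyRate --off` to reactivate) — unstaffed, not closed; items shared with open routes are served there. `ledger route dormant <id> --off` reactivates.

# Route EntropyRate — a scale-uniform entropy rate of the Liouville word removes the log — natural
binary Chowla by decrement-free entropy, then Hardy–Littlewood pairs

BARRIER INVERSION (operator C) of the logarithmic-averaging wall at the level of its mechanism.
Tao's two-point theorem (arXiv:1509.05422) is logarithmic for ONE reason: the mutual information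
I(X_H : Y_H) between the Liouville sign word of length H and the residues n mod p (p ≍ H) is bounded
only through the DECREMENT of the block-entropy rate, I(X_H:Y_H) ≤ H·[h(H) − h(kH)] + O(H/k) (his
relative subadditivity, which needs translation invariance only), and a small decrement is found by
pigeonhole over H at a FIXED distribution of n — while the dilation n ↦ pn moves the natural scale x
to px, so the good H would have to be good at the scale ≍ H·x it itself determines (the diagonal).
Tao–Teräväinen (arXiv:1809.02518, Thm 1.17, §5) already run the whole argument at natural scale and
get binary Chowla at ALL scales when the word has FEW sign patterns (then I ≤ H(X_H) is trivially
small). The door of this route is the complementary, expected case stated as one scale-uniform law: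
X₁ = UniformEntropyRate — for every ε and k there are arbitrarily large H such that at every large
scale X the empirical per-symbol entropies of the H-word and of the kH-word of λ differ by ≤ ε/log
H. Then I(X_H:Y_H) = o(H/log H) at EVERY scale with no pigeonhole, the Tao–Teräväinen isotopy
formula holds without logarithmic weights, and Matomäki–Radziwiłł–Tao's prime-lag averaged Chowla
(known at natural scale) gives binary Chowla at natural density for every fixed shift (node
ChowlaFixed, via the supports PrimeLagChowla + EntropyTransfer). X₂ = FixedShiftLiouvilleLaw (the
Hardy–Littlewood error at shift h is a non-zero constant times the Chowla sum, LiouvilleOpening's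
law at slope 1) turns this into Hardy–Littlewood pairs PairsHL (target, stmt-Parity-9387), and X₃ =
PairsToGHL (shared residual stmt-Parity-9389) decides the Statement. It suffices to show X = X₁ ∧ X₂
∧ X₃. Realises no existing card.
Lean: `UniformEntropyRate ∧ FixedShiftLiouvilleLaw ∧ PairsToGHL`

## Assembly
Pure logic plus one o(N)-bookkeeping step, sorry-free in Sketch.lean / glue.lean (lean check rc 0):
`theorem closes (hE : UniformEntropyRate) (hM : PrimeLagChowla) (hT : EntropyTransfer) (hL :
FixedShiftLiouvilleLaw) (hR : PairsToGHL) : GeneralizedHardyLittlewood` first builds `have hP :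
PairsHL` (for each h: (A − 𝔖N − cC) + c·C = A − 𝔖N with C = o(N) from hT hM hE,
IsLittleO.add/const_mul_left, `ring`), then `exact hR hP` — binders = three OPEN cruxes + the known
support PrimeLagChowla + the provable support EntropyTransfer; every binder occurs in the proof term
and the target PairsHL is named in it; conclusion the sub-problem Statement by name (offline audit
of the rendered file: binder_used = all five, codes [], axioms propext/Classical.choice/Quot.sound).

Rationale: WHY THIS LINE. Assuming the catalogued walls, a GHL route must (i) carry a λ/Λ-specific parity input
invisible to Type-I data (SelbergParity, PrimePairParity), (ii) not be a fixed-order uniformity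
argument (TrueComplexityBinary), (iii) reach NATURAL density without a generic log→Cesàro transfer
(LogarithmicAveraging: not_logToMeanTransfer_bounded/_nonneg), and (iv) keep its Siegel content in a
declared place (not_generalizedHardyLittlewood_of_unboundedSiegelZeros). Reading Tao 2016 §3 and
Tao–Teräväinen 2019 §5 against Helfgott–Radziwiłł (arXiv:2103.06853, Cor. 1.1: fairness at a
SPECIFIED scale and prime set IS proved, but only with Σ_{p∈𝐏}1/p → ∞, i.e. multi-scale primes,
whence their output is again logarithmic — a dyadic prime set has no expansion) shows that for a
dyadic prime set the only missing input at natural scale is information-theoretic: a bound on the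
entropy-rate decrement uniform in the scale. The door is exactly that bound, an ∞-order statistic of
λ (outside every U^s class), implied by Chowla and by 'the block entropy h_X(H) converges as X → ∞
for each H' (pigeonhole along k^j·H, harmonic divergence — the route's own reduction), and it
unifies Tao–Teräväinen's low-entropy theorem with the high-entropy world in one statement; NOTE that
an entropy FLOOR h ≥ log 2 − o(1) would NOT do as a door — by the chain rule h_X(H) ≤ log 2 − (1 −
d/H)c_d²/2 it is equivalent to full natural Chowla — which is why the decrement, not the floor, is
filed. Imported area: Shannon information theory / entropy of stationary processes (Kolmogorov–Sinai
rate, relative subadditivity) on top of pretentious multiplicative number theory (MR/MRT); nothing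
spectral or sieve-theoretic. Versus the listed routes: LiouvilleOpening files natural two-point
Chowla as a primitive crux; PolynomialKatai (the other operator-C inversion of the same wall)
CONSERVES the scale by dilating the slope with polynomially large primes, where fairness is free
(large sieve) and the Matomäki–Radziwiłł input becomes the conjectural door; here the primes stay
tiny, the MR input is a theorem, and fairness is bought by the entropy law — the dual way to pay; no
other route uses entropy of λ at all.

RANKED CRUXES. #0 PairsHL (target) — Hardy–Littlewood pairs in Λ-form at every FIXED shift: for h ≥
1, Σ_{n≤N} Λ(n)Λ(n+h) − 𝔖({0,h})·N = o(N) (verbatim stmt-Parity-9387, shared with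
LiouvilleShiftedTables/TauberianTwins); reached inside `closes` as `have hP : PairsHL` from
FixedShiftLiouvilleLaw and EntropyTransfer PrimeLagChowla UniformEntropyRate (glue.lean). (why it
might fail: it is the twin-prime asymptotic (h = 2) and every fixed even gap; parity-hard; on this
route it inherits the entropy law and the relative level hidden in the Liouville law.)
[HardyLittlewood1923, GreenTao2010, arXiv:1809.02518]
#2 UniformEntropyRate (crux) — THE DOOR (scale-uniform entropy rate of the Liouville word). Write
h_X(M) for the per-symbol Shannon entropy (nats) of the empirical law of the sign word
(λ(n+1),…,λ(n+M)), n uniform in [0,X). For every ε > 0 and k ≥ 2 there are arbitrarily large H such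
that for all X ≥ X₀(H): h_X(H) − h_X(kH) ≤ ε/log H. Consumed through Tao's inequality I(X_H:Y_H) ≤
H[h(H) − h(kH)] + O(H/k) at every scale; implied by the Chowla conjecture, by 'few sign patterns'
(Tao–Teräväinen's hypothesis, where h ≤ ε/log H), and by mere CONVERGENCE of h_X(H) as X → ∞ for
each H (birth skeleton: convergence ∧ antitone rate ⟹ door by pigeonhole along k^j·H). [difficulty:
open-problem] (why it might fail: natural-scale block statistics of λ are unknown beyond length-4
patterns (s(K) ≫ K² only); a 'diagonal conspiracy' — the rate dropping by ≫ 1/log H between H and kH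
exactly at scales ≍ H·x for every large H — is consistent with all log-averaged theorems (Tao 2016
p.9).) [arXiv:1509.05422, arXiv:1809.02518, arXiv:2103.06853, arXiv:1509.01545, arXiv:1804.08556]
#3 FixedShiftLiouvilleLaw (crux) — FIXED-SHIFT LIOUVILLE LAW: for every h ≥ 1 there is a constant
c_h ≠ 0 with Σ_{n≤N}Λ(n)Λ(n+h) − 𝔖({0,h})N − c_h·Σ_{n≤N}λ(n)λ(n+h) = o(N) — the Hardy–Littlewood
error at shift h IS a non-zero multiple of the Chowla sum. The slope-1, fixed-shift instance (via
the shift-pair dictionary, tree: singularSeries_pair_eq_singularProduct) of LiouvilleOpening's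
PairLiouvilleLaw (stmt-Parity-16147; intended witness its Euler-product cofactor constant 𝔠_Ψ,
(3/2)ζ(2)·∏ local factors at h = 2), hence implied by that route's RelativeChowlaLevel ∧ LawOfLevel
∧ SignedCofactorConstant; with ChowlaFixed it gives PairsHL (the `have hP` step of `closes`,
proved). [difficulty: open-problem] (why it might fail: rests on a RELATIVE (mean-free) level
N^(1−δ) of λ(n)λ(n+h) in progressions (LiouvilleOpening.RelativeChowlaLevel, EH-shaped, open beyond
level 1/2) and on convergence of the λ-signed cofactor series; with c ≠ 0 it is false in a world
where HL(h) holds but Chowla(h) fails.) [arXiv:1509.05422, MurtyVatwani2017,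
DukeFriedlanderIwaniec1997, Polymath8b2014, HardyLittlewood1923]
#4 PairsToGHL (crux) — DECLARED RESIDUAL (complementary sector, staffed last; verbatim
stmt-Parity-9389, shared with LiouvilleShiftedTables, RoughSemiprimeRigidity, LiouvilleMAD,
HullDial): fixed-shift Hardy–Littlewood pairs imply the Statement — prime k-tuples for k ≥ 3,
general slopes, shift-uniformity h ≤ LN (Landau–Siegel-complete by the standing disprover's Negative
theorems) and d ≥ 2 via the proved fibration lemma. The entropy mechanism extends verbatim to
k-point correlations at fixed shifts (the window must contain the pattern), so the natural-density
k-point Chowla part of this residual is again an entropy-rate statement — recorded in NOT DECOMPOSED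
YET, not filed. [deps: PairsHL] [difficulty: open-problem] (why it might fail: false in the illusory
world given PairsHL (Cruxes/PairsToGHL/Disproof.lean §3: UnboundedSiegelZeros ∧ PairsHL ⊢
¬PairsToGHL, system (n, n+2q_exc)); contains prime k-tuple parity for k ≥ 3; GHL-hard as typed and
trivially implied BY the Statement (consequence used toward S).) [GreenTao2010,
MatomakiMerikoski2023, Dickson1904, arXiv:1809.02518]
#9 PrimeLagChowla (support) — KNOWN INPUT (Matomäki–Radziwiłł–Tao 2015 averaged Chowla in the
prime-lag form used by Tao 2016 Lemmas 3.6–3.7 with eq. (2.9), natural scale, as invoked in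
Tao–Teräväinen 2019 §5): for every h ≥ 1 and ε > 0, for P ≥ P₀ and X ≥ X₀(P): Σ_{p prime ∈ [P,2P)}
|Σ_{n≤X} λ(n)λ(n+ph)| ≤ ε·X·#{p prime ∈ [P,2P)}. Filed as a support so that a grounder can vendor it
as a Literature fact; no route content. [difficulty: L] [arXiv:1503.05121, arXiv:1509.05422,
arXiv:1809.02518, arXiv:1501.04585]
#9 ChowlaFixed (support) — NODE (not to be staffed directly on this route; it is the consequent of
EntropyTransfer and the antecedent of pairsHL_of): binary Chowla at natural density for every fixed
shift, Σ_{n≤N} λ(n)λ(n+h) = o(N) for h ≥ 1 — the classical conjecture (Tao 2016 log-averaged;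
Tao–Teräväinen 2019 at almost all scales; Helfgott–Radziwiłł / Pilatte rates). [difficulty:
open-problem] [arXiv:1509.05422, arXiv:1809.02518, arXiv:2103.06853, Chowla1965]
#9 EntropyTransfer (support) — THE LEVER AS A THEOREM (provable now, XL): PrimeLagChowla →
UniformEntropyRate → ChowlaFixed. Proof = Tao–Teräväinen 2019 §5 verbatim (correspondence principle
at natural scale along subsequences; improved isotopy formula sup_d E_{P≤p<2P}|f_{dp}(1) − f_d(p)| ≤
ε unless I(X^(d):Y^(d)) > ε⁵2^m/m; then f_1(1) = E_p f_{1/p}(p) + O(ε) and PrimeLagChowla) with the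
mutual information bounded NOT by H(X) (few patterns) but by Tao 2016 §3: H(X_{kH}|Y) ≤ k·H(X_H|Y) +
o(1) (translation invariance only) ⟹ I(X_H:Y) ≤ H[h(H)−h(kH)] + H(Y)/k + o(1) ≤ εH/log H + O(H/k) by
the door; entropies of subsequential limit laws are limits of empirical entropies (finite alphabet,
continuity), so the door transfers to every limit process. [difficulty: XL] [arXiv:1809.02518,
arXiv:1509.05422, arXiv:1503.05121]

TWO-LAYER PLAN. UniformEntropyRate ⇐ BlockEntropyConverges → RateAntitone → UniformEntropyRate
(birth skeleton bc/UniformEntropyRate_birth.lean: for each M the limit r(M) = lim_X h_X(M) exists;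
r(kM) ≤ r(M); pigeonhole along M_j = k^j·M₀ with Σ_j ε/(2 log M_j) = ∞ forces infinitely many j with
r(M_j) − r(M_{j+1}) ≤ ε/(2 log M_j)). FixedShiftLiouvilleLaw ⇐ RelativeChowlaLevelFixed →
LawOfLevelFixed → FixedShiftLiouvilleLaw (LiouvilleOpening's cut at slope 1). PairsToGHL ⇐
PairsToDimOne → (DimOne → GHL, PROVED: leeYangFibres_fibrationLemma) — the shared crux's own lines
(Cruxes/PairsToGHL).

KILL CRITERIA. Refutation of UniformEntropyRate (a theorem exhibiting, for some ε,k, eventual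
decrement > ε/log H at arbitrarily large scales for ALL large H) closes the route outright (close
--reason refuted:UniformEntropyRate) — it would be a remarkable structure theorem for λ. A proof
that EntropyTransfer FAILS (the Tao–Teräväinen §5 argument does not accept the decrement bound in
place of the pattern count) forces a pivot to the weaker door 'sup over scales of I(X_H:Y_H) =
o(H/log H) for arbitrarily large H' (Tao–Teräväinen's literal hypothesis) or retirement. Refutation
of FixedShiftLiouvilleLaw with c ≠ 0 (HL true, Chowla false at some h) kills this route and
LiouvilleOpening/PolynomialKatai alike. A proof of natural binary Chowla elsewhere moots the door
(the route then reduces to FixedShiftLiouvilleLaw ∧ PairsToGHL, i.e. to LiouvilleOpening's lower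
half).

NOT DECOMPOSED YET. (a) The k-point version: the same inequality bounds I(X_H:Y_H) for any window
functional, so UniformEntropyRate also yields natural-density k-point Chowla at fixed shifts for ODD
k (Tao–Teräväinen Remark after Thm 1.17 needs the hypothesis for all large K) — a rung of
PairsToGHL's k-tuple sector, not filed. (b) The convergence split of the door (Two-layer plan) and
the even weaker 'Cauchy along one chain' form. (c) Shift-uniformity: the entropy window must contain
the lag, so shifts h ≤ H/3 only; h ≤ LN stays inside PairsToGHL (Siegel-complete) — deliberately not
attacked. (d) Quantitative form: HR/Pilatte-type rates would follow from a quantitative decrement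
law; not needed for o(N).

CHEAPEST FALSIFIER. (1) A refuter re-derives EntropyTransfer on paper from arXiv:1809.02518 §5 +
arXiv:1509.05422 §3 (two pages): if the decrement bound cannot replace the pattern-count bound at
the point 'Repeating the arguments in [tt] verbatim', the lever is dead — I checked the three
inequalities used (relative subadditivity needs translation invariance only, Tao's Lemma 2.5 with q
= 1; H(Y_H) ≪ H; continuity of entropy on a finite simplex) and found no use of affine invariance.
(2) kit numerics (not run — hub is compute-free and the check is only a sanity plot): h_X(H) for X =
10^6…10^9, H ≤ 24, at 40 log-spaced scales: visible scale-oscillation of the decrement would be a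
numerical shadow of the diagonal conspiracy (none expected). (3) Lookup: any paper proving
'block-entropy convergence ⟹ unweighted Chowla' or its negation (searched, none found).

NUMBERS. Tao 2016: I(X_H,Y_H) must be o(H/log H) ('barely smaller than H/log H', p.12); prime set
𝒫_H ⊂ [ε²H/2, ε²H]; H located in [H₋,H₊] by pigeonhole, H₊ double-exponential in ε. Tao–Teräväinen
2019 Thm 1.17: few patterns = s(K) < exp(εK/log K); known s(K) ≫ K² (McNamara, via TT19 Rem. 1.18),
s(K) ≥ K+5 (MRT 2016). Helfgott–Radziwiłł 2021: eigenvalues O(√(K𝓛)) need 𝓛 = Σ_{p∈𝐏}1/p ≥ e; Cor.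
1.5 rate O(1/√(log log w)). Needed decrement: ≤ ε/log H per symbol between H and kH with k ≍ (log
H)/ε³.

DEFINITION REQUESTS. blockEntropy (the empirical per-symbol Shannon entropy of the Liouville sign
word, inlined in UniformEntropyRate via Real.negMulLog over Fin M → Bool) would read better as a
named notion: `ledger workitem add --kind definition --notion liouvilleBlockEntropy --topic
Summits/Parity/GeneralizedHardyLittlewood/Theorems` (to be filed after open). Cite facts wanted (for
PrimeLagChowla's grounding): MatomakiRadziwillTao2015 Thm 1.? (averaged Chowla) in the prime-lag
form of Tao 2016 Lemmas 3.6–3.7.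

Novelty: Searches (2026-08-17): lit search --source arxiv ×8 ('Helfgott Radziwill expansion divisibility
parity' → arXiv:2103.06853 read Cor 1.1–1.8, §1.4.2; 'Chowla conjecture almost all scales Tao
Teravainen' → arXiv:1809.02518 read §1, Thm 1.17, §5 in full; 'sign patterns Liouville function
entropy' / 'Liouville function positive entropy sign patterns superpolynomial' → arXiv:2007.15644
only; 'unweighted Chowla conjecture natural density entropy decrement' → 0; 'Furstenberg systems
Liouville function entropy' → arXiv:1804.08556, arXiv:1708.00677 (log only, grep
'entropy|unweighted'); 'McNamara sign patterns' → 0); arXiv:1509.05422 read pp. 8–12 (Lemma 2.5,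
Prop 2.6, §3 to eq. (xh2)); lit galaxy search "entropy decrement" --star all (16 rows: Tao 2016,
Tao–Teräväinen Gowers-uniformity; rest noise); local hybrid searchd unavailable this session
(ConnectionResetError, recorded); internal: the 14 open route files, 15 retired, negatives (3),
Ideas/ and Ideas/_closed grep 'entropy' (cards monotone-sandwich-diagonal-entropy [closed vacuous:
diagonal ED for SMOOTH pairs, Erdős–Pomerance], free-dilation-transport [closed known],
dilation-budget-degree-dial [closed], scale-averaging-dichotomy [closed known]).
Nearest prior art found: arXiv:1809.02518 Thm 1.17/§5 (few sign patterns ⟹ binary Chowla at all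
scales — the low-entropy half of the same inequality); arXiv:1509.05422 §3 eq. (xh2) (the decrement
inequality, used there only through pigeonhole at a log-distribution); internal closed card  [refs: 2103.06853, 1809.02518, 2007.15644, 1804.08556, 1708.00677, 1509.05422]

Barriers (technique_class: entropy-decrement, information-theory, liouville-opening): - technique_class: entropy-decrement, information-theory, liouville-opening
- Literature.Barriers.Parity.LogarithmicAveraging: the wall inverted. Its theorem (no
LogToMeanTransfer for bounded / non-negative correlation sequences, Hall's set) is respected:
nothing is transferred from a log-mean of the correlation sequence; the logarithm enters Tao's proof
only through the pigeonhole over H at a fixed distribution, and the door deletes that pigeonhole —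
evasion by an arithmetic hypothesis on λ, stated as the crux UniformEntropyRate.
- Literature.Barriers.Parity.LogarithmicAveragingScope: the sharpened class (windowed log estimates
(α) + almost-all-scales (β) + soft properties of the correlation SEQUENCE ⟹ all scales: refuted by
the bump–dip sequence) is not entered: the route does not deduce all scales from (α)/(β); it re-runs
Tao–Teräväinen's natural-scale §5 argument under a NEW hypothesis about λ itself (its block-entropy
rate), i.e. 'using multiplicativity … of a new kind', which the record's scope_caveats declare
unsettled and not a no-go; its positive evasion (c) (a good scale in every [X,(1+ε)X]) is not used
either.
- Literature.Barriers.Parity.TrueComplexityBinary: not a uniformity-norm argument — the controlling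
quantity is the Shannon entropy rate of the λ-word (all orders at once); the refuted classes
GowersControlsBinary / GowersControlsShift / BinaryInverseTheorem are not instantiated.
- Literature.Barriers.Parity.CriticalDensityHalf: no dense model and no pseudora

History (route lifecycle, newest last):
- 2026-08-24T19:59:57Z · DORMANT — reconciler: no traction for 7 d (last activity statement-attached at 2026-08-17T18:44:29Z); parked, not closed — `ledger route dormant route-Parity-EntropyRate (operator:999:3597186)
- 2026-08-28T19:19:02Z · REACTIVATED — reconciler: reactivated — activity item-evidence-added at 2026-08-28T17:02:41Z after parking at 2026-08-24T19:59:57Z (operator:999:2139348)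
- 2026-09-04T02:20:14Z · DORMANT — reconciler: no traction for 5 d (last activity statement-attached at 2026-08-30T01:27:31Z); parked, not closed — `ledger route dormant route-Parity-EntropyRate (operator:999:2535552)

sub-problem: GeneralizedHardyLittlewood · status: dormant · opened planner-plan-novel-Parity-GeneralizedHardyLittl-03955878-c-v2-g17-0 2026-08-17T04:45:58Z · rev 1 · ledger route-Parity-EntropyRate
GENERATED by the gate from the ledger (D-0016/17). Provers cite these decls: `theorem foo : Summit.Parity.GeneralizedHardyLittlewood.Theses.EntropyRate.<Decl> := …` in Summits/Parity/GeneralizedHardyLittlewood/Theorems/<Name>.lean.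
-/

namespace Summit.Parity.GeneralizedHardyLittlewood.Theses.EntropyRate

open scoped BigOperators Topology Manifold Classical MeasureTheory ProbabilityTheory Matrix InnerProductSpace ComplexConjugate ContinuousMap
open Filter Set Function TopologicalSpace MeasureTheory

attribute [summit_statement] _root_.GeneralizedHardyLittlewood

/-- item stmt-Parity-9387 · target · rank 0 · open · by planner
why it might fail: it is the twin-prime asymptotic (h = 2) and every fixed even gap; parity-hard; on this route it inherits the entropy law and the relative level hidden in the Liouville law.
sources: HardyLittlewood1923, GreenTao2010, arXiv:1809.02518
[support] Hardy–Littlewood pairs, Λ-form, fixed shift: for every h ≥ 1, Σ_{n≤N} Λ(n)Λ(n+h) =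
𝔖({0,h})·N + o(N). Verbatim the signature of TauberianTwins.PairsHL (stmt-Parity-0867): the terminal
statement of this bridge (k-tuples and shift-uniform GHL are NOT claimed; see route DicksonFibration
for PairsHL → DimOne → GHL). [difficulty: open-problem] -/
@[route_item "route-Parity-EntropyRate"]
def PairsHL : Prop :=
  ∀ h : ℕ, 1 ≤ h → (fun N : ℕ => ∑ n ∈ Finset.Icc 1 N, ArithmeticFunction.vonMangoldt n * ArithmeticFunction.vonMangoldt (n + h) - Literature.NumberTheory.Sieve.singularSeries ({0, (h : ℤ)} : Finset ℤ) * N) =o[Filter.atTop] fun N : ℕ => (N : ℝ)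

/-- item stmt-Parity-17876 · crux · rank 2 · open · by planner
why it might fail: natural-scale block statistics of λ are unknown beyond length-4 patterns (s(K) ≫ K² only); a 'diagonal conspiracy' — the rate dropping by ≫ 1/log H between H and kH exactly at scales ≍ H·x for every large H — is consistent with all log-averaged theorems (Tao 2016 p.9).
sources: arXiv:1509.05422, arXiv:1809.02518, arXiv:2103.06853, arXiv:1509.01545, arXiv:1804.08556
[crux] THE DOOR (scale-uniform entropy rate of the Liouville word). Write h_X(M) for the per-symbol
Shannon entropy (nats) of the empirical law of the sign word (λ(n+1),…,λ(n+M)), n uniform in [0,X).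
For every ε > 0 and k ≥ 2 there are arbitrarily large H such that for all X ≥ X₀(H): h_X(H) −
h_X(kH) ≤ ε/log H. Consumed through Tao's inequality I(X_H:Y_H) ≤ H[h(H) − h(kH)] + O(H/k) at every
scale; implied by the Chowla conjecture, by 'few sign patterns' (Tao–Teräväinen's hypothesis, where
h ≤ ε/log H), and by mere CONVERGENCE of h_X(H) as X → ∞ for each H (birth skeleton: convergence ∧
antitone rate ⟹ door by pigeonhole along k^j·H). [difficulty: open-problem] -/
@[route_item "route-Parity-EntropyRate"]
def UniformEntropyRate : Prop :=
  ∀ ε : ℝ, 0 < ε → ∀ k : ℕ, 2 ≤ k → ∀ H₁ : ℕ, ∃ H : ℕ, H₁ ≤ H ∧ 2 ≤ H ∧ ∃ X₀ : ℕ, ∀ X : ℕ, X₀ ≤ X → let freq : (M : ℕ) → (Fin M → Bool) → ℝ := fun M w => ((((Finset.range X).filter (fun n : ℕ => ∀ j : Fin M, (ArithmeticFunction.liouville (n + 1 + (j : ℕ)) = 1 ↔ w j = true))).card : ℕ) : ℝ) / X; let ent : ℕ → ℝ := fun M => ∑ w : Fin M → Bool, Real.negMulLog (freq M w); ent H / H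 - ent (k * H) / ((k * H : ℕ) : ℝ) ≤ ε / Real.log H

/-- item stmt-Parity-17877 · crux · rank 3 · open · by planner
why it might fail: rests on a RELATIVE (mean-free) level N^(1−δ) of λ(n)λ(n+h) in progressions (LiouvilleOpening.RelativeChowlaLevel, EH-shaped, open beyond level 1/2) and on convergence of the λ-signed cofactor series; with c ≠ 0 it is false in a world where HL(h) holds but Chowla(h) fails.
sources: arXiv:1509.05422, MurtyVatwani2017, DukeFriedlanderIwaniec1997, Polymath8b2014, HardyLittlewood1923
[crux] FIXED-SHIFT LIOUVILLE LAW: for every h ≥ 1 there is a constant c_h ≠ 0 with Σ_{n≤N}Λ(n)Λ(n+h)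
− 𝔖({0,h})N − c_h·Σ_{n≤N}λ(n)λ(n+h) = o(N) — the Hardy–Littlewood error at shift h IS a non-zero
multiple of the Chowla sum. The slope-1, fixed-shift instance (via the shift-pair dictionary, tree:
singularSeries_pair_eq_singularProduct) of LiouvilleOpening's PairLiouvilleLaw (stmt-Parity-16147;
intended witness its Euler-product cofactor constant 𝔠_Ψ, (3/2)ζ(2)·∏ local factors at h = 2), hence
implied by that route's RelativeChowlaLevel ∧ LawOfLevel ∧ SignedCofactorConstant; with ChowlaFixed
it gives PairsHL (the `have hP` step of `closes`, proved). [difficulty: open-problem] -/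
@[route_item "route-Parity-EntropyRate"]
def FixedShiftLiouvilleLaw : Prop :=
  ∀ h : ℕ, 1 ≤ h → ∃ c : ℝ, c ≠ 0 ∧ (fun N : ℕ => ∑ n ∈ Finset.Icc 1 N, ArithmeticFunction.vonMangoldt n * ArithmeticFunction.vonMangoldt (n + h) - Literature.NumberTheory.Sieve.singularSeries ({0, (h : ℤ)} : Finset ℤ) * N - c * ∑ n ∈ Finset.Icc 1 N, (((ArithmeticFunction.liouville n * ArithmeticFunction.liouville (n + h) : ℤ)) : ℝ)) =o[Filter.atTop] fun N : ℕ => (N : ℝ)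

/-- item stmt-Parity-9389 · crux · rank 4 · open · by planner
why it might fail: false in the illusory world given PairsHL (Cruxes/PairsToGHL/Disproof.lean §3: UnboundedSiegelZeros ∧ PairsHL ⊢ ¬PairsToGHL, system (n, n+2q_exc)); contains prime k-tuple parity for k ≥ 3; GHL-hard as typed and trivially implied BY the Statement (consequence used toward S).
sources: GreenTao2010, MatomakiMerikoski2023, Dickson1904, arXiv:1809.02518
[support] (RESIDUAL — GHL-hard, NOT addressed by this mechanism; filed so that `closes` decides the
sub-problem, D-0027 §2.1) fixed-shift Hardy–Littlewood pairs (the PairsHL statement, inlined) →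
GeneralizedHardyLittlewood (Green–Tao Conj. 1.2, all d, t, L, convex K). Contains: prime k-tuples
for every k ≥ 3 at fixed shifts (a k-fold version of the rigidity would first need 'tuple-GEH':
level 1 for (k−1)-fold products of shifted prime/rough weights); general slopes a_i n + b_i;
shift-uniformity |b_i| ≤ LN (Landau–Siegel-hard: a Siegel zero mod q forces ΣΛ(n)Λ(n+q) ≈ 2𝔖_q x,
MatomakiMerikoski2023 Thm 1.3); and the fibration d ≥ 2 ⇐ d = 1 (route DicksonFibration, provable).
True if GHL is; unprovable by anything here. [difficulty: open-problem] -/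
@[route_item "route-Parity-EntropyRate"]
def PairsToGHL : Prop :=
  (∀ h : ℕ, 1 ≤ h → (fun N : ℕ => ∑ n ∈ Finset.Icc 1 N, ArithmeticFunction.vonMangoldt n * ArithmeticFunction.vonMangoldt (n + h) - Literature.NumberTheory.Sieve.singularSeries ({0, (h : ℤ)} : Finset ℤ) * N) =o[Filter.atTop] fun N : ℕ => (N : ℝ)) → GeneralizedHardyLittlewood

/-- item stmt-Parity-17879 · crux (kind.auto-crux: conjecture-grade) · rank 9 · open · by planner
why it might fail: auto-crux — conjecture-grade statement (docstring avows it ('conjecture')); it is open, so it may simply be false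
sources: arXiv:1509.05422, arXiv:1809.02518, arXiv:2103.06853, Chowla1965
[support] NODE (not to be staffed directly on this route; it is the consequent of EntropyTransfer
and the antecedent of pairsHL_of): binary Chowla at natural density for every fixed shift, Σ_{n≤N}
λ(n)λ(n+h) = o(N) for h ≥ 1 — the classical conjecture (Tao 2016 log-averaged; Tao–Teräväinen 2019
at almost all scales; Helfgott–Radziwiłł / Pilatte rates). [difficulty: open-problem] -/
@[route_item "route-Parity-EntropyRate"]
def ChowlaFixed : Prop :=
  ∀ h : ℕ, 1 ≤ h → (fun N : ℕ => ∑ n ∈ Finset.Icc 1 N, (((ArithmeticFunction.liouville n * ArithmeticFunction.liouville (n + h) : ℤ)) : ℝ)) =o[Filter.atTop] fun N : ℕ => (N : ℝ)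

/-- item stmt-Parity-17878 · support · rank 9 · open · by planner
sources: arXiv:1503.05121, arXiv:1509.05422, arXiv:1809.02518, arXiv:1501.04585
[support] KNOWN INPUT (Matomäki–Radziwiłł–Tao 2015 averaged Chowla in the prime-lag form used by Tao
2016 Lemmas 3.6–3.7 with eq. (2.9), natural scale, as invoked in Tao–Teräväinen 2019 §5): for every
h ≥ 1 and ε > 0, for P ≥ P₀ and X ≥ X₀(P): Σ_{p prime ∈ [P,2P)} |Σ_{n≤X} λ(n)λ(n+ph)| ≤ ε·X·#{p
prime ∈ [P,2P)}. Filed as a support so that a grounder can vendor it as a Literature fact; no route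
content. [difficulty: L] -/
@[route_item "route-Parity-EntropyRate"]
def PrimeLagChowla : Prop :=
  ∀ h : ℕ, 1 ≤ h → ∀ ε : ℝ, 0 < ε → ∃ P₀ : ℕ, ∀ P : ℕ, P₀ ≤ P → ∃ X₀ : ℕ, ∀ X : ℕ, X₀ ≤ X → ∑ p ∈ (Finset.Ico P (2 * P)).filter Nat.Prime, |∑ n ∈ Finset.Icc 1 X, (((ArithmeticFunction.liouville n * ArithmeticFunction.liouville (n + p * h) : ℤ)) : ℝ)| ≤ ε * X * (((Finset.Ico P (2 * P)).filter Nat.Prime).card : ℝ)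

/-- item stmt-Parity-17880 · support · rank 9 · open · by planner
sources: arXiv:1809.02518, arXiv:1509.05422, arXiv:1503.05121
[support] THE LEVER AS A THEOREM (provable now, XL): PrimeLagChowla → UniformEntropyRate →
ChowlaFixed. Proof = Tao–Teräväinen 2019 §5 verbatim (correspondence principle at natural scale
along subsequences; improved isotopy formula sup_d E_{P≤p<2P}|f_{dp}(1) − f_d(p)| ≤ ε unless
I(X^(d):Y^(d)) > ε⁵2^m/m; then f_1(1) = E_p f_{1/p}(p) + O(ε) and PrimeLagChowla) with the mutual
information bounded NOT by H(X) (few patterns) but by Tao 2016 §3: H(X_{kH}|Y) ≤ k·H(X_H|Y) + o(1)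
(translation invariance only) ⟹ I(X_H:Y) ≤ H[h(H)−h(kH)] + H(Y)/k + o(1) ≤ εH/log H + O(H/k) by the
door; entropies of subsequential limit laws are limits of empirical entropies (finite alphabet,
continuity), so the door transfers to every limit process. [difficulty: XL] -/
@[route_item "route-Parity-EntropyRate"]
def EntropyTransfer : Prop :=
  PrimeLagChowla → UniformEntropyRate → ChowlaFixed

/-- item stmt-Parity-17881 · assembly · rank 1 · open · by planner
sources: arXiv:1809.02518, arXiv:1509.05422, GreenTao2010
[assembly] UniformEntropyRate → PrimeLagChowla → EntropyTransfer → FixedShiftLiouvilleLaw →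
PairsToGHL → GeneralizedHardyLittlewood (the type of `closes`). -/
@[route_item "route-Parity-EntropyRate"]
def Assembly : Prop :=
  UniformEntropyRate → PrimeLagChowla → EntropyTransfer → FixedShiftLiouvilleLaw → PairsToGHL → GeneralizedHardyLittlewood

/-! D-0027 §2.1 — DECIDING THEOREM (planner-authored via `route open/edit --closes-file`; by planner-plan-novel-Parity-GeneralizedHardyLittl-03955878-c-v 2026-08-17T04:45:58Z):
its hypotheses are this route's items and its conclusion the sub-problem Statement (glue_lint), and it elaborates with this file. -/

@[closes "route-Parity-EntropyRate"] theorem closes (hE : UniformEntropyRate) (hM : PrimeLagChowla) (hT : EntropyTransfer)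
    (hL : FixedShiftLiouvilleLaw) (hR : PairsToGHL) : GeneralizedHardyLittlewood := by
  have hP : PairsHL := by
    intro h hh
    obtain ⟨c, -, hc⟩ := hL h hh
    have h3 := hc.add ((hT hM hE h hh).const_mul_left c)
    refine h3.congr' (Filter.Eventually.of_forall fun N => ?_) (Filter.Eventually.of_forall fun N => rfl)
    ring
  exact hR hP

end Summit.Parity.GeneralizedHardyLittlewood.Theses.EntropyRate
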